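import Mathlib
import Summits.ValiantsHypothesis.ValiantsHypothesis.Theorems.DivisionGapZeroOneTransferCofactorChargingMonomialTop
import Summits.ValiantsHypothesis.ValiantsHypothesis.Theorems.DivisionGapZeroOneTransferProjClosureAux
import Summits.ValiantsHypothesis.ValiantsHypothesis.Theorems.TriangularDimersDivisionEasy.Negative.UnitH

/-!
# Crux `DivisionGap.ZeroOneTransfer` (stmt-ValiantsHypothesis-5066), line `charged-uncharged`, Part D-IV
(lead c12): MM certificates for `D_n` have NO MONOMIAL INITIAL OR FINAL FORM in any `D_n`-degenerate direction

The partial charging theorem of lead c8 (`cofactorCharging_monomialTop`, p137731: `f` `w`-homogeneous and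
`top_w h` a single monomial ⇒ `L(f) ≤ ((n+2)(L(f·h)+3))^κ`) is stated for per-shaped variable types
`Fin n × Fin n`.  This file transports it to the crux-4 variable type `(Fin n × Fin n) × (Fin n × Fin n)` of
`D_n = triPM n` (renaming along `Fin n × Fin n ≃ Fin (n·n)`; complexity is invariant under injective
renamings), adds the twin for BOTTOM components (equally free over `ℝ≥0`, `ProjClosure.complexity_botComponent_le`),
and draws the consequence for uncharged certificates of the decisive instance:

* `monomialTop_charging`, `monomialBot_charging` — for `f, h ∈ ℝ≥0[x_(v,w)]`, `f` `w`-homogeneous and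
  `top_w h` (resp. `bot_w h`) a monomial `c·x^u`, `c ≠ 0`: `L₊(f) ≤ ((n·n + 2)(L₊(f·h) + 3))^κ`.
* `not_mm_certificate_monomialTop`, `not_mm_certificate_monomialBot` — no constant `c` admits, for every `n`,
  an `X` with a MONOMIAL initial (resp. final) form in some direction `w` along which `D_n` is homogeneous
  (row weights, column weights, non-edge weights, and their sums) and `L₊(D_n · X) ≤ 2^((log₂ n + c)^c)`.
  Example killed: the vertex-star product `Π_v Σ_{w∼v} x_(v,w)` (omnipresent, order `n²`, in the edge
  ideal, not a power — it survives Parts D-I–D-III) has a single monomial as initial form for every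
  injective column weight.
[cite: JuknaSeiwertSergeev2022, Lemma 2] [cite: Valiant1980, §3 Thm 1]
-/

noncomputable section

-- `Summit.ValiantsHypothesis.ValiantsHypothesis.…` is the tree's mandated single-conjunct layout
-- (Sub = Summit), so the duplicated namespace component is intended.
set_option linter.dupNamespace false

namespace Summit.ValiantsHypothesis.ValiantsHypothesis.Theorems.DivisionGapZeroOneTransfer

open MvPolynomial
open Literature.Computability.AlgebraicComplexity
open Summit.ValiantsHypothesis.ValiantsHypothesis.Theorems.TriangularDimersDivisionEasy.Negative
open Summit.ValiantsHypothesis.ValiantsHypothesis.Theorems.ZeroOneTransfer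
open scoped NNReal BigOperators

namespace MmMonomialInitialForm

variable {n : ℕ}

/-- **JSS contraction on vertex-indexed variables** (transport of `stub_jssContraction` along
`Fin n × Fin n ≃ Fin (n·n)`): removing a monomial cofactor costs `((n·n + 2)(L + 2))^κ`.
[cite: JuknaSeiwertSergeev2022, Lemma 2] -/
theorem jssContraction_vtx :
    ∃ κ : ℕ, ∀ (n : ℕ) (f : MvPolynomial ((Fin n × Fin n) × (Fin n × Fin n)) ℝ≥0)
      (u : (Fin n × Fin n) × (Fin n × Fin n) →₀ ℕ),
      complexity f ≤ ((n * n + 2) * (complexity (monomial u (1 : ℝ≥0) * f) + 2)) ^ κ := by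
  obtain ⟨κ, hκ⟩ := DivisionGapPerDivisionHard.stub_jssContraction
  refine ⟨κ, fun n f u => ?_⟩
  classical
  -- rename the vertex type `Fin n × Fin n` to `Fin (n * n)`
  have hcard : Fintype.card (Fin n × Fin n) = n * n := by simp
  set e : Fin n × Fin n ≃ Fin (n * n) := Fintype.equivFinOfCardEq hcard with he
  set E : (Fin n × Fin n) × (Fin n × Fin n) → Fin (n * n) × Fin (n * n) := fun p => (e p.1, e p.2) with hE
  have hEinj : Function.Injective E := by
    intro p q hpq
    simp only [hE, Prod.mk.injEq] at hpq
    exact Prod.ext (e.injective hpq.1) (e.injective hpq.2)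
  have h1 : complexity (rename E f) = complexity f := complexity_rename_of_injective_holds hEinj f
  have h2 : complexity (rename E (monomial u (1 : ℝ≥0) * f)) = complexity (monomial u (1 : ℝ≥0) * f) :=
    complexity_rename_of_injective_holds hEinj _
  have h3 : rename E (monomial u (1 : ℝ≥0) * f) = monomial (u.mapDomain E) (1 : ℝ≥0) * rename E f := by
    rw [map_mul, rename_monomial]
  have := hκ (n * n) (rename E f) (u.mapDomain E)
  rw [h1, ← h3, h2] at this
  exact this

/-- Bottom twin of `MonomialTop.complexity_mul_monomial_le`: if `f` is `w`-homogeneous and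
`bot_w h = c x^u` then `L(f · c x^u) ≤ L(f h)` (bottom forms are multiplicative and free over `ℝ≥0`).
[folklore] -/
theorem complexity_mul_monomial_le_bot {σ : Type*} (w : σ → ℕ) {f : MvPolynomial σ ℝ≥0}
    (h : MvPolynomial σ ℝ≥0) {d : ℕ} {u : σ →₀ ℕ} {c : ℝ≥0} (hf : IsWeightedHomogeneous w f d)
    (hh : ProjClosure.botComponent w h = monomial u c) :
    complexity (f * monomial u c) ≤ complexity (f * h) := by
  have hbot : ProjClosure.botComponent w (f * h) = f * monomial u c := by
    rw [ProjClosure.botComponent_mul, ProjClosure.botComponent_eq_self_of_isWeightedHomogeneous w hf, hh]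
  rw [← hbot]
  exact ProjClosure.complexity_botComponent_le w (f * h)

end MmMonomialInitialForm

open MmMonomialInitialForm

/-- **Monomial initial forms are chargeable (vertex-indexed variables).**  If `f` is `w`-homogeneous and
the `w`-initial form of the cofactor `h` is a single monomial `c·x^u` (`c ≠ 0`), then
`L₊(f) ≤ ((n·n + 2)(L₊(f·h) + 3))^κ`: initial forms are free, one scalar gate normalises `c`, and the
JSS contraction removes `x^u`. [cite: JuknaSeiwertSergeev2022, Lemma 2] -/
theorem monomialTop_charging :
    ∃ κ : ℕ, ∀ (n : ℕ) (w : (Fin n × Fin n) × (Fin n × Fin n) → ℕ)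
      (f h : MvPolynomial ((Fin n × Fin n) × (Fin n × Fin n)) ℝ≥0) (d : ℕ)
      (u : (Fin n × Fin n) × (Fin n × Fin n) →₀ ℕ) (c : ℝ≥0),
      MvPolynomial.IsWeightedHomogeneous w f d → c ≠ 0 → Negative.topComponent w h = MvPolynomial.monomial u c →
      complexity f ≤ ((n * n + 2) * (complexity (f * h) + 3)) ^ κ := by
  obtain ⟨κ, hκ⟩ := jssContraction_vtx
  refine ⟨κ, fun n w f h d u c hf hc hh => ?_⟩
  have h1 : complexity (monomial u (1 : ℝ≥0) * f) ≤ complexity (f * h) + 1 :=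
    (MonomialTop.complexity_monomial_one_mul_le f u hc).trans
      (Nat.add_le_add_right (MonomialTop.complexity_mul_monomial_le w h hf hh) 1)
  calc complexity f ≤ ((n * n + 2) * (complexity (monomial u (1 : ℝ≥0) * f) + 2)) ^ κ := hκ n f u
    _ ≤ ((n * n + 2) * (complexity (f * h) + 3)) ^ κ :=
        Nat.pow_le_pow_left (Nat.mul_le_mul_left _ (by omega)) κ

/-- **Monomial FINAL forms are chargeable too** (bottom components, equally free over `ℝ≥0`).
[cite: JuknaSeiwertSergeev2022, Lemma 2] -/
theorem monomialBot_charging :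
    ∃ κ : ℕ, ∀ (n : ℕ) (w : (Fin n × Fin n) × (Fin n × Fin n) → ℕ)
      (f h : MvPolynomial ((Fin n × Fin n) × (Fin n × Fin n)) ℝ≥0) (d : ℕ)
      (u : (Fin n × Fin n) × (Fin n × Fin n) →₀ ℕ) (c : ℝ≥0),
      MvPolynomial.IsWeightedHomogeneous w f d → c ≠ 0 → ProjClosure.botComponent w h = MvPolynomial.monomial u c →
      complexity f ≤ ((n * n + 2) * (complexity (f * h) + 3)) ^ κ := by
  obtain ⟨κ, hκ⟩ := jssContraction_vtx
  refine ⟨κ, fun n w f h d u c hf hc hh => ?_⟩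
  have h1 : complexity (monomial u (1 : ℝ≥0) * f) ≤ complexity (f * h) + 1 :=
    (MonomialTop.complexity_monomial_one_mul_le f u hc).trans
      (Nat.add_le_add_right (complexity_mul_monomial_le_bot w h hf hh) 1)
  calc complexity f ≤ ((n * n + 2) * (complexity (monomial u (1 : ℝ≥0) * f) + 2)) ^ κ := hκ n f u
    _ ≤ ((n * n + 2) * (complexity (f * h) + 3)) ^ κ :=
        Nat.pow_le_pow_left (Nat.mul_le_mul_left _ (by omega)) κ

namespace MmMonomialInitialForm

/-- Exponent bookkeeping: `κ (2m + (m+c)^c + 3) ≤ (m + (c + 3 + 2κ))^(c + 3 + 2κ)`. [folklore] -/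
theorem kappa_bound (κ m c : ℕ) : κ * (2 * m + (m + c) ^ c + 3) ≤ (m + (c + 3 + 2 * κ)) ^ (c + 3 + 2 * κ) := by
  set B := m + (c + 3 + 2 * κ) with hB
  have hB3 : 3 ≤ B := by omega
  have h1 : 2 * m + 3 ≤ B ^ 2 := by nlinarith
  have h2 : (m + c) ^ c ≤ B ^ c := Nat.pow_le_pow_left (by omega) c
  have h3 : B ^ 2 ≤ B ^ (c + 2) := Nat.pow_le_pow_right (by omega) (by omega)
  have h4 : B ^ c ≤ B ^ (c + 2) := Nat.pow_le_pow_right (by omega) (by omega)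
  have h5 : 2 * m + (m + c) ^ c + 3 ≤ 2 * B ^ (c + 2) := by omega
  have h6 : 2 * κ ≤ B := by omega
  calc κ * (2 * m + (m + c) ^ c + 3) ≤ κ * (2 * B ^ (c + 2)) := Nat.mul_le_mul_left _ h5
    _ = (2 * κ) * B ^ (c + 2) := by ring
    _ ≤ B * B ^ (c + 2) := Nat.mul_le_mul_right _ h6
    _ = B ^ (c + 3) := by ring
    _ ≤ B ^ (c + 3 + 2 * κ) := Nat.pow_le_pow_right (by omega) (by omega)

/-- From a charging bound `L₊(D_n) ≤ ((n·n+2)(2^((log₂ n + c)^c) + 3))^κ` at `n = 2^m`: the quasi-polynomial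
form `L₊(D_{2^m}) ≤ 2^((m + c')^c')` with `c' = c + 3 + 2κ`. [folklore] -/
theorem qp_of_charging {κ c m : ℕ} (hm : 1 ≤ m)
    (h : complexity (triPM (2 ^ m)) ≤ ((2 ^ m * 2 ^ m + 2) * (bound c (2 ^ m) + 3)) ^ κ) :
    complexity (triPM (2 ^ m)) ≤ 2 ^ ((m + (c + 3 + 2 * κ)) ^ (c + 3 + 2 * κ)) := by
  have hlog : Nat.log 2 (2 ^ m) = m := Nat.log_pow (by norm_num) _
  unfold bound at h
  rw [hlog] at h
  have h1 : 2 ^ m * 2 ^ m + 2 ≤ 2 ^ (2 * m + 1) := by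
    have e : 2 ^ m * 2 ^ m = 2 ^ (2 * m) := by rw [← pow_add]; ring_nf
    rw [e, pow_succ]
    have : 2 ≤ 2 ^ (2 * m) := by
      calc 2 = 2 ^ 1 := by norm_num
        _ ≤ 2 ^ (2 * m) := Nat.pow_le_pow_right (by norm_num) (by omega)
    omega
  have h2 : 2 ^ ((m + c) ^ c) + 3 ≤ 2 ^ ((m + c) ^ c + 2) := by
    rw [pow_add]
    have : 1 ≤ 2 ^ ((m + c) ^ c) := Nat.one_le_two_pow
    omega
  calc complexity (triPM (2 ^ m)) ≤ ((2 ^ m * 2 ^ m + 2) * (2 ^ ((m + c) ^ c) + 3)) ^ κ := h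
    _ ≤ (2 ^ (2 * m + 1) * 2 ^ ((m + c) ^ c + 2)) ^ κ := Nat.pow_le_pow_left (Nat.mul_le_mul h1 h2) κ
    _ = 2 ^ (κ * (2 * m + (m + c) ^ c + 3)) := by
        rw [← pow_add, ← pow_mul]; congr 1; ring
    _ ≤ 2 ^ ((m + (c + 3 + 2 * κ)) ^ (c + 3 + 2 * κ)) :=
        Nat.pow_le_pow_right (by norm_num) (kappa_bound κ m c)

/-- A charging bound of that shape for ALL `n` contradicts Valiant's lower bound. [cite: Valiant1980, §3 Thm 1] -/
theorem false_of_charging {κ c : ℕ}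
    (H : ∀ n, complexity (triPM n) ≤ ((n * n + 2) * (bound c n + 3)) ^ κ) : False := by
  obtain ⟨m, hm6, hviol⟩ := exists_m_violating (c + 3 + 2 * κ)
  have he : Even (2 ^ m) := Nat.even_pow.2 ⟨even_two, by omega⟩
  have h64 : 64 ≤ 2 ^ m := by
    calc 64 = 2 ^ 6 := by norm_num
      _ ≤ 2 ^ m := Nat.pow_le_pow_right (by norm_num) hm6
  have hF := qp_of_charging (by omega) (H (2 ^ m))
  have hlb : ∀ L, 24 * L + 60 ≤ 2 ^ m →
      Tfib ^ L ≤ 4 * complexity (triPM (2 ^ m)) * (2 ^ m * 2 ^ m + 1) ^ 2 * (Tfib - 1) ^ L :=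
    fun L hL => monotone_lower_bound h64 he hL
  have hkey := key_ineq_of_bound hm6 hlb hF
  exact absurd (hkey.trans_lt hviol) (lt_irrefl _)

end MmMonomialInitialForm

/-- **No MM certificate for `D_n` has a monomial INITIAL form in a `D_n`-degenerate direction.**  No
constant `c` admits, for every `n`, a weight `w` with `D_n` `w`-homogeneous (row / column / non-edge weights
and their sums) and an `X` whose `w`-initial form is a single monomial `a·x^u`, `a ≠ 0`, with
`L₊(D_n · X) ≤ 2^((log₂ n + c)^c)`. [cite: JuknaSeiwertSergeev2022, Lemma 2] [cite: Valiant1980, §3 Thm 1] -/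
theorem not_mm_certificate_monomialTop :
    ¬ ∃ c : ℕ, ∀ n : ℕ, ∃ (X : MvPolynomial ((Fin n × Fin n) × (Fin n × Fin n)) ℝ≥0)
      (w : (Fin n × Fin n) × (Fin n × Fin n) → ℕ) (d : ℕ) (u : (Fin n × Fin n) × (Fin n × Fin n) →₀ ℕ) (a : ℝ≥0),
      MvPolynomial.IsWeightedHomogeneous w (triPM n) d ∧ a ≠ 0 ∧
      Negative.topComponent w X = MvPolynomial.monomial u a ∧ complexity (triPM n * X) ≤ bound c n := by
  rintro ⟨c, H⟩
  obtain ⟨κ, hκ⟩ := monomialTop_charging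
  refine MmMonomialInitialForm.false_of_charging (κ := κ) (c := c) fun n => ?_
  obtain ⟨X, w, d, u, a, hhom, ha, htop, hle⟩ := H n
  exact (hκ n w (triPM n) X d u a hhom ha htop).trans
    (Nat.pow_le_pow_left (Nat.mul_le_mul_left _ (by omega)) κ)

/-- **No MM certificate for `D_n` has a monomial FINAL form in a `D_n`-degenerate direction** (bottom
twin). [cite: JuknaSeiwertSergeev2022, Lemma 2] [cite: Valiant1980, §3 Thm 1] -/
theorem not_mm_certificate_monomialBot :
    ¬ ∃ c : ℕ, ∀ n : ℕ, ∃ (X : MvPolynomial ((Fin n × Fin n) × (Fin n × Fin n)) ℝ≥0)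
      (w : (Fin n × Fin n) × (Fin n × Fin n) → ℕ) (d : ℕ) (u : (Fin n × Fin n) × (Fin n × Fin n) →₀ ℕ) (a : ℝ≥0),
      MvPolynomial.IsWeightedHomogeneous w (triPM n) d ∧ a ≠ 0 ∧
      ProjClosure.botComponent w X = MvPolynomial.monomial u a ∧ complexity (triPM n * X) ≤ bound c n := by
  rintro ⟨c, H⟩
  obtain ⟨κ, hκ⟩ := monomialBot_charging
  refine MmMonomialInitialForm.false_of_charging (κ := κ) (c := c) fun n => ?_
  obtain ⟨X, w, d, u, a, hhom, ha, hbot, hle⟩ := H n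
  exact (hκ n w (triPM n) X d u a hhom ha hbot).trans
    (Nat.pow_le_pow_left (Nat.mul_le_mul_left _ (by omega)) κ)

end Summit.ValiantsHypothesis.ValiantsHypothesis.Theorems.DivisionGapZeroOneTransfer

end
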